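import Summits.QuantumFields.YangMills.Theorems.BalabanUVNodesN18RunDifferenceOfLocalTermsRecord

/-!
# BalabanUVNodes ∕ N18 — THE TERMWISE RUN-DIFFERENCE ROAD, PART 4 (END TO END): node N18's letters for W1-20's (1.7) localized sum — and OF RECORD under W1-20's law — FROM
# ANALYTICITY OF THE MATCHED (2.13) TERMS + ONE TERM-LEVEL TWO-RUN SUP BOUND `‖G_B X − G_A X‖ ≤ M₀ θ^{k+1} e^{−κ d(X)}` on the (4.35) analyticity ball, with the minimizer tails
# `‖ι X e_{l,t,c}‖ ≤ B₃ e^{−δ₀ dist(t, X)}` in the cast geometry of record — no Σ-shape, no geometry, no leaf left as a parameter (`M = L^{m′}`)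
# (Track A, DAG node N18 = NE5; key K3⁸ `SpineGivenEndpointR13SepCoPHV` = stmt-QuantumFields-27366; cell `pub-ymgap`, WIDTH SEAT `pub-ymgap-dag-n18-w2` g9, FILE 4;
# `--kind proof --supports stmt-QuantumFields-27366 --as helper`, COUNT-NEUTRAL; THEOREMS ONLY, 0 `def`, 0 `sorry`)

WHY.  PART 1 §2 (`abs_polWindow_runDifference_localizedSum_le_soft_of_holomorphic`) turns, per run pair and matched pair of domains, HOLOMORPHIC data — the two runs' (2.13) terms
read in def-B's exponential chart as real parts of functions `G_B X`, `G_A X` holomorphic on an open `U ⊇ ball 0 r` through ONE per-term real-linear complexification `ι X` of the probe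
fields of `T^{(k+2)}_{K+1}` with site weights, and a sup bound `‖G_B X − G_A X‖ ≤ M X` on the ball — into the Σ-shaped windowed run-difference bound `Σ_X 16 M(X) r⁻² w_X(z·) w_X(0·)`;
PART 2 §4∕§6 turn Σ-shaped bounds with K-uniform soft majorants into W1-19b's `WindowedStepRate … 1 …`, node N18's `KernelStepRate` and the letter OF RECORD `KernelStepRateOfRecord₁₃`
with the (5.10) leaves discharged on def-T's catalogue (dag-n22-w2).  THIS FILE composes the two with dag-n22-w2's arithmetic junction in mind (`WindowSoftTwoPoint.softBound_of_weighted`: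
`16·(M₀ w_h e_d)∕r²·(B₃e_x)(B₃e_y) = (16M₀B₃²∕r²)·w_h·e_d·e_x·e_y`, here an identity), so that the producer of node N18's letter reads ONE statement whose analytic inputs are
print-shaped: [I] p. 264 «an analytic function … uniformly bounded … together with all derivatives» for each (1.7) term (NODE A), p. 282 ∕ (4.35)–(4.37) for the tails through the
minimizer (`B₃ e^{−δ₀ dist(t,X)}`), and — the node's CONTENT, NOT PRINTED for d = 4 — the TWO-RUN SUP BOUND with rate `θ^{k+1}` and (1.18) decay `e^{−κ d(X)}` for the matched terms
(King's «the error is the same graph with a difference of propagators on one line», [King1986] p. 665, at the level of the (2.13) terms).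

WHAT (`M = L^{m′}`; constants `(r, M₀, B₃, κ, δ₀)` free of `(k, w, μ, ν, z, K, X)`; `δ₁ := ½min{δ₀, κ(4M)⁻¹}`, `C_E := 16 M₀ B₃²∕r²`, `C₅′ := C_E e^{12Mδ₁}K₀(64,8)K₁(4,δ₀∕2)`):
★★★ `windowedStepRate_localizedSum_one_of_holomorphicTwoRun` (⇒ `WindowedStepRate F (localizedSum F S emb) ρ bV γ 1 δ₁ θ (C₅′·θ)`) · ★★ `kernelStepRate_localizedSum_of_holomorphicTwoRun`
(+ `PolLimitsExist … (Window γ)`) · ★★★ `kernelStepRateOfRecord₁₃_of_holomorphicTwoRun` (record chart `θ.ρ8 ∕ θ.bV`, under `Localizes17OfRecord₁₃ F N θ S emb` + `PolLimitsExistOfRecord₁₃ F N θ`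
⇒ `KernelStepRateOfRecord₁₃ F N θ δ₁ θ₅ C₅′` — THE LETTER THE K3 PIN READS FOR NODE N18).

HONEST FRAMING — what this is NOT.  Count-neutral composition (PART 1 §2 + PART 2 §4∕§6 + real arithmetic); NO estimate of Bałaban's is proved or asserted — the holomorphic
extensions, the tails' constant `B₃`, the radius `r`, the two-run sup bound `M₀ θ^{k+1} e^{−κ d(X)}` (term-level NE5), (1.21)-existence and W1-20's law are DISPLAYED hypotheses (NODE A ∕
N10 ∕ the node's content); nothing of the merged term (1.6) or of the (2.13) terms constructed; no letter OF RECORD inhabited; N18 ∕ N22 ∕ (D4) NOT discharged; K3⁸ OPEN (v6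
b4e55110ab73e679), not claimed; counts UNMOVED (typed 28∕28 · discharged 5∕27 (A 5∕28)); one finite four-torus programme at fixed ε, Bałaban AS PRINTED; R4 closes the conditional
finite-𝕋⁴ rung `BalabanLadder.UV` only — NOT ℝ⁴, NOT infinite volume, NOT OS, NOT a mass gap; the Clay problem is NOT proved by any of this.

References (TYPES only): [I] = [Balaban1987RG1] Thm 1 p. 259, (1.7) p. 261, (1.18) p. 263, (1.20)–(1.21) p. 264, (4.35)–(4.37) p. 282, (5.10) p. 293; [II] = [Balaban1988RG2Cluster]
(2.13)–(2.14) pp. 14–15; C. King, CMP 102 (1986) [King1986] (3.73) p. 665.  Imports PART 2 (through it PART 1, dag-n22-w2's three storeys, dag-n22-c's J27∕J28, def-W1's files) BY NAME.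
-/

noncomputable section

namespace YMDAG.N18.RunDifferenceOfLocalTerms

open Filter Metric Set
open scoped BigOperators Topology
open Literature.MathematicalPhysics.QuantumFieldTheory.Balaban1983to89
open Literature.MathematicalPhysics.QuantumFieldTheory.Balaban1983to89.T4Continuum (T4Family)
open Literature.MathematicalPhysics.QuantumFieldTheory.Balaban1983to89.FlowStep (Box)
open Literature.MathematicalPhysics.QuantumFieldTheory.Balaban1983to89.B12PolarizationTensor120 (expChart)
open Literature.MathematicalPhysics.QuantumFieldTheory.Balaban1983to89.Node00 (Stage13Params siteOfInt MatA)
open Literature.MathematicalPhysics.QuantumFieldTheory.Balaban1983to89.Node00.U3KernelLetters (WindowedStepRate KernelStepRate PolLimitsExist PolLimitsExistOfRecord₁₃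
  KernelStepRateOfRecord₁₃ polLimitsExistOfRecord₁₃_iff_of_localizes kernelStepRateOfRecord₁₃_iff_of_localizes)
open Literature.MathematicalPhysics.QuantumFieldTheory.Balaban1983to89.Node00.LocalizedSum17 (localizedSum ReadingMaps Localizes17OfRecord₁₃)
open Literature.MathematicalPhysics.QuantumFieldTheory.Balaban1983to89.Node00.Sect2 (domSys domCount)
open Literature.MathematicalPhysics.QuantumFieldTheory.Balaban1983to89.Node00.W1 (ClusterTower castDom domSys_succ)
open Literature.MathematicalPhysics.QuantumFieldTheory.Balaban1983to89.T4LevelShift (siteShift)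
open Literature.MathematicalPhysics.QuantumFieldTheory.Balaban1983to89.T4OutputRate (Window)
open Literature.MathematicalPhysics.QuantumFieldTheory.Balaban1983to89.B12Decay510 (delta1)
open Literature.MathematicalPhysics.QuantumFieldTheory.Balaban1983to89.B12Decay510Window (K₁)
open Literature.MathematicalPhysics.QuantumFieldTheory.Balaban1983to89.B12Decay510Torus (distCT nearT)
open Literature.MathematicalPhysics.QuantumFieldTheory.Balaban1983to89.B12TreeDecay (K₀ kappa₀)
open Literature.MathematicalPhysics.QuantumFieldTheory.Balaban1983to89.TreeLengthTorus (TPt torusTreeLen)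
open YMDAG.N18.TwoRunWindowLevelShift (ladder)
open YMDAG.N18.AtRecordOfKernelLetters (kernelStepRate_of_windowed')

section Reading

variable {𝔄 : Type*} [NormedRing 𝔄] [NormedAlgebra ℝ 𝔄] {V : Type*} [NormedAddCommGroup V] [NormedSpace ℝ V] {ι : Type*} [Fintype ι] {𝔸 : Type*}
  {Ec : Type*} [NormedAddCommGroup Ec] [NormedSpace ℂ Ec]
variable (F : T4Family) (m' : ℕ) (M : ℕ) [NeZero M] (hM : M = F.L ^ m')
variable (S : (K : ℕ) → ClusterTower (F.P K) 𝔸 M) (emb : ReadingMaps F 𝔄 𝔸) (ρ : V →L[ℝ] 𝔄) (bV : Module.Basis ι ℝ V)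

include hM in
/-- ★★★ **W1-19b's TWO-RUN LETTER FOR THE LOCALIZED SUM FROM ANALYTICITY + ONE TERM-LEVEL TWO-RUN SUP BOUND** (`s = 1`, `M = L^{m′}`).  For every level `k`, box history
`w ∈ ]0,γ]^{k+2}`, run pair `(K, K+1)` and run-B domain `X ∈ 𝐃_{k+2}(T_{K+1})` let there be given: a real-linear complexification `ι` of the probe fields of `T^{(k+2)}_{K+1}` whose one-site
colour directions carry the minimizer tails `‖ι e_{l,t,c}‖ ≤ B₃ e^{−δ₀ distCT(cast t, X)}` ([I] p. 282 ∕ (4.35)), functions `G_B, G_A` holomorphic on an open `U ⊇ ball 0 r` with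
`Re G_B(ι B) =` run B's term `Re E^{(k+2)}_{K+1}(X; w; ·)` in def-B's chart and `Re G_A(ι B) =` run A's matched term `Re E^{(k+1)}_K(cast X; tail w; · ∘ shift)` ([I] p. 264 analyticity),
and THE TWO-RUN SUP BOUND `‖G_B − G_A‖ ≤ M₀ θ^{k+1} e^{−κ d(X)}` on the ball (term-level NE5 — DISPLAYED, the node's content), with `(r, M₀, B₃, κ, δ₀)` free of everything
(`δ₀ > 0`, `κ∕2 ≥ κ₀(64,8)`).  THEN `WindowedStepRate F (localizedSum F S emb) ρ bV γ 1 δ₁ θ (C₅′·θ)`, `δ₁ = ½min{δ₀, κ(4M)⁻¹}`, `C₅′ = (16M₀B₃²∕r²) e^{12Mδ₁}K₀(64,8)K₁(4,δ₀∕2)`.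
[cite: Balaban1987RG1, Thm 1 p.259, (1.7) p.261, (1.18) p.263, (1.20)-(1.21) p.264, (4.35)-(4.37) p.282 and (5.10) p.293; King1986, (3.73) p.665] -/
theorem windowedStepRate_localizedSum_one_of_holomorphicTwoRun {γ θ r M₀ B₃ κ δ₀ : ℝ} (hθ : 0 ≤ θ) (hr : 0 < r) (hM₀ : 0 ≤ M₀) (hB₃ : 0 ≤ B₃) (hδ₀ : 0 < δ₀)
    (hκ : kappa₀ (4 * 2 ^ 4) (2 * 4) ≤ κ / 2)
    (ιc : (k : ℕ) → (Fin (k + 2) → ℝ) → (K : ℕ) → (domSys (F.P (K + 1)) M (k + 1 + 1)).Dom → ((Fin (F.P (K + 1)).d → Site (F.P (K + 1)) (k + 1 + 1) → V) →L[ℝ] Ec))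
    (GB GA : (k : ℕ) → (Fin (k + 2) → ℝ) → (K : ℕ) → (domSys (F.P (K + 1)) M (k + 1 + 1)).Dom → Ec → ℂ)
    (U : (k : ℕ) → (Fin (k + 2) → ℝ) → (K : ℕ) → (domSys (F.P (K + 1)) M (k + 1 + 1)).Dom → Set Ec) (hU : ∀ k w K X, IsOpen (U k w K X))
    (hGB : ∀ k w K X, DifferentiableOn ℂ (GB k w K X) (U k w K X)) (hGA : ∀ k w K X, DifferentiableOn ℂ (GA k w K X) (U k w K X))
    (hrU : ∀ k w K X, ball (0 : Ec) r ⊆ U k w K X)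
    (hfB : ∀ (k : ℕ) (w : Fin (k + 2) → ℝ), w ∈ Box γ (k + 1) → ∀ (K : ℕ) (X : (domSys (F.P (K + 1)) M (k + 1 + 1)).Dom) (B),
      expChart (fun W' => (((S (K + 1)) (k + 1)).E w (emb (K + 1) (k + 1) W') X).re) ρ B = (GB k w K X (ιc k w K X B)).re)
    (hfA : ∀ (k : ℕ) (w : Fin (k + 2) → ℝ), w ∈ Box γ (k + 1) → ∀ (K : ℕ) (X : (domSys (F.P (K + 1)) M (k + 1 + 1)).Dom) (B),
      expChart (fun W' : Fin (F.P (K + 1)).d → Site (F.P (K + 1)) (k + 1 + 1) → 𝔄 =>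
        (((S K) k).E (Fin.tail w) (emb K k (fun κ' y => W' κ' (siteShift (ladder F K k) y))) (castDom (domSys_succ F M K (k + 1)) X)).re) ρ B = (GA k w K X (ιc k w K X B)).re)
    (hsup : ∀ (k : ℕ) (w : Fin (k + 2) → ℝ), w ∈ Box γ (k + 1) → ∀ (K : ℕ) (X : (domSys (F.P (K + 1)) M (k + 1 + 1)).Dom), ∀ ζ ∈ ball (0 : Ec) r,
      ‖GB k w K X ζ - GA k w K X ζ‖ ≤ M₀ * θ ^ (k + 1) * Real.exp (-κ * torusTreeLen X.1))
    (htail : ∀ (k : ℕ) (w : Fin (k + 2) → ℝ) (K : ℕ) (X : (domSys (F.P (K + 1)) M (k + 1 + 1)).Dom) (l : Fin (F.P (K + 1)).d) (t : Site (F.P (K + 1)) (k + 1 + 1)) (c : ι),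
      let e : Site (F.P (K + 1)) (k + 1 + 1) → TPt 4 (domCount (F.P (K + 1)) M (k + 1 + 1) * M) :=
        fun x i => (ZMod.cast (x i) : ZMod (domCount (F.P (K + 1)) M (k + 1 + 1) * M))
      ‖ιc k w K X (Pi.single l (Pi.single t (bV c)))‖ ≤ B₃ * Real.exp (-δ₀ * distCT (domCount (F.P (K + 1)) M (k + 1 + 1)) M (e t) (nearT (M := M) (e t) X))) :
    WindowedStepRate F (localizedSum F S emb) ρ bV γ 1 (delta1 δ₀ κ ((M : ℝ) * 4)) θ
      (16 * M₀ * B₃ ^ 2 / r ^ 2 * Real.exp (delta1 δ₀ κ ((M : ℝ) * 4) * ((M : ℝ) * 4) * 3) * K₀ (4 * 2 ^ 4) (2 * 4) * K₁ 4 (δ₀ / 2) * θ) := by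
  have hCE : 0 ≤ 16 * M₀ * B₃ ^ 2 / r ^ 2 := by positivity
  refine windowedStepRate_localizedSum_one_of_softSum F m' M hM S emb ρ bV hCE hθ hδ₀ hκ
    (fun k w μ ν z K X =>
      16 * M₀ * B₃ ^ 2 / r ^ 2 * θ ^ (k + 1) * Real.exp (-κ * torusTreeLen X.1) *
        Real.exp (-δ₀ * distCT (domCount (F.P (K + 1)) M (k + 1 + 1)) M
          (fun i => (ZMod.cast (siteOfInt F (K + 1) (k + 1 + 1) z i) : ZMod (domCount (F.P (K + 1)) M (k + 1 + 1) * M)))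
          (nearT (M := M) (fun i => (ZMod.cast (siteOfInt F (K + 1) (k + 1 + 1) z i) : ZMod (domCount (F.P (K + 1)) M (k + 1 + 1) * M))) X)) *
        Real.exp (-δ₀ * distCT (domCount (F.P (K + 1)) M (k + 1 + 1)) M
          (fun i => (ZMod.cast (siteOfInt F (K + 1) (k + 1 + 1) 0 i) : ZMod (domCount (F.P (K + 1)) M (k + 1 + 1) * M)))
          (nearT (M := M) (fun i => (ZMod.cast (siteOfInt F (K + 1) (k + 1 + 1) 0 i) : ZMod (domCount (F.P (K + 1)) M (k + 1 + 1) * M))) X)))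
    (fun k w hw μ ν z K => ?_) (fun k w hw μ ν z K X => le_rfl)
  -- the Σ-shape: PART 1 §2 at the data of this `(k, w, K)`, site weights `B₃ e^{−δ₀ distCT(cast ·, X)}`, followed by the arithmetic
  -- `16·(M₀ θ^{k+1} e_d)∕r²·(B₃e_z)(B₃e_0) = (16M₀B₃²∕r²)·θ^{k+1}·e_d·e_z·e_0` (dag-n22-w2's `softBound_of_weighted` as an identity)
  refine (abs_polWindow_runDifference_localizedSum_le_soft_of_holomorphic F S emb ρ bV K k w (ιc k w K) (GB k w K) (GA k w K) (U k w K) (hU k w K)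
    (hGB k w K) (hGA k w K) hr (hrU k w K) (hfB k w hw K) (hfA k w hw K) (fun X => M₀ * θ ^ (k + 1) * Real.exp (-κ * torusTreeLen X.1)) (hsup k w hw K)
    (fun X t => B₃ * Real.exp (-δ₀ * distCT (domCount (F.P (K + 1)) M (k + 1 + 1)) M
      (fun i => (ZMod.cast (t i) : ZMod (domCount (F.P (K + 1)) M (k + 1 + 1) * M)))
      (nearT (M := M) (fun i => (ZMod.cast (t i) : ZMod (domCount (F.P (K + 1)) M (k + 1 + 1) * M))) X)))
    (fun X t => mul_nonneg hB₃ (Real.exp_pos _).le) (htail k w K) μ ν z).trans (le_of_eq (Finset.sum_congr rfl fun X _ => ?_))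
  ring

include hM in
/-- ★★ **NODE N18's LETTER `KernelStepRate` FOR THE LOCALIZED SUM FROM ANALYTICITY + THE TERM-LEVEL TWO-RUN SUP BOUND** (+ W1-19b's `PolLimitsExist … (Window γ)`; dag-n18-w1's
`kernelStepRate_of_windowed'` at `s = 1`): `KernelStepRate F (localizedSum F S emb) ρ bV γ δ₁ θ C₅′`. [cite: Balaban1987RG1, Thm 1 p.259, (1.7) p.261, (1.21) p.264 and (5.10) p.293; King1986, (3.73) p.665] -/
theorem kernelStepRate_localizedSum_of_holomorphicTwoRun {γ θ r M₀ B₃ κ δ₀ : ℝ} (hex : PolLimitsExist F (localizedSum F S emb) ρ bV (Window γ))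
    (hθ : 0 ≤ θ) (hr : 0 < r) (hM₀ : 0 ≤ M₀) (hB₃ : 0 ≤ B₃) (hδ₀ : 0 < δ₀) (hκ : kappa₀ (4 * 2 ^ 4) (2 * 4) ≤ κ / 2)
    (ιc : (k : ℕ) → (Fin (k + 2) → ℝ) → (K : ℕ) → (domSys (F.P (K + 1)) M (k + 1 + 1)).Dom → ((Fin (F.P (K + 1)).d → Site (F.P (K + 1)) (k + 1 + 1) → V) →L[ℝ] Ec))
    (GB GA : (k : ℕ) → (Fin (k + 2) → ℝ) → (K : ℕ) → (domSys (F.P (K + 1)) M (k + 1 + 1)).Dom → Ec → ℂ)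
    (U : (k : ℕ) → (Fin (k + 2) → ℝ) → (K : ℕ) → (domSys (F.P (K + 1)) M (k + 1 + 1)).Dom → Set Ec) (hU : ∀ k w K X, IsOpen (U k w K X))
    (hGB : ∀ k w K X, DifferentiableOn ℂ (GB k w K X) (U k w K X)) (hGA : ∀ k w K X, DifferentiableOn ℂ (GA k w K X) (U k w K X))
    (hrU : ∀ k w K X, ball (0 : Ec) r ⊆ U k w K X)
    (hfB : ∀ (k : ℕ) (w : Fin (k + 2) → ℝ), w ∈ Box γ (k + 1) → ∀ (K : ℕ) (X : (domSys (F.P (K + 1)) M (k + 1 + 1)).Dom) (B),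
      expChart (fun W' => (((S (K + 1)) (k + 1)).E w (emb (K + 1) (k + 1) W') X).re) ρ B = (GB k w K X (ιc k w K X B)).re)
    (hfA : ∀ (k : ℕ) (w : Fin (k + 2) → ℝ), w ∈ Box γ (k + 1) → ∀ (K : ℕ) (X : (domSys (F.P (K + 1)) M (k + 1 + 1)).Dom) (B),
      expChart (fun W' : Fin (F.P (K + 1)).d → Site (F.P (K + 1)) (k + 1 + 1) → 𝔄 =>
        (((S K) k).E (Fin.tail w) (emb K k (fun κ' y => W' κ' (siteShift (ladder F K k) y))) (castDom (domSys_succ F M K (k + 1)) X)).re) ρ B = (GA k w K X (ιc k w K X B)).re)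
    (hsup : ∀ (k : ℕ) (w : Fin (k + 2) → ℝ), w ∈ Box γ (k + 1) → ∀ (K : ℕ) (X : (domSys (F.P (K + 1)) M (k + 1 + 1)).Dom), ∀ ζ ∈ ball (0 : Ec) r,
      ‖GB k w K X ζ - GA k w K X ζ‖ ≤ M₀ * θ ^ (k + 1) * Real.exp (-κ * torusTreeLen X.1))
    (htail : ∀ (k : ℕ) (w : Fin (k + 2) → ℝ) (K : ℕ) (X : (domSys (F.P (K + 1)) M (k + 1 + 1)).Dom) (l : Fin (F.P (K + 1)).d) (t : Site (F.P (K + 1)) (k + 1 + 1)) (c : ι),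
      let e : Site (F.P (K + 1)) (k + 1 + 1) → TPt 4 (domCount (F.P (K + 1)) M (k + 1 + 1) * M) :=
        fun x i => (ZMod.cast (x i) : ZMod (domCount (F.P (K + 1)) M (k + 1 + 1) * M))
      ‖ιc k w K X (Pi.single l (Pi.single t (bV c)))‖ ≤ B₃ * Real.exp (-δ₀ * distCT (domCount (F.P (K + 1)) M (k + 1 + 1)) M (e t) (nearT (M := M) (e t) X))) :
    KernelStepRate F (localizedSum F S emb) ρ bV γ (delta1 δ₀ κ ((M : ℝ) * 4)) θ
      (16 * M₀ * B₃ ^ 2 / r ^ 2 * Real.exp (delta1 δ₀ κ ((M : ℝ) * 4) * ((M : ℝ) * 4) * 3) * K₀ (4 * 2 ^ 4) (2 * 4) * K₁ 4 (δ₀ / 2)) :=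
  kernelStepRate_of_windowed' F ρ bV 1 hex
    (windowedStepRate_localizedSum_one_of_holomorphicTwoRun F m' M hM S emb ρ bV hθ hr hM₀ hB₃ hδ₀ hκ ιc GB GA U hU hGB hGA hrU hfB hfA hsup htail)

end Reading

/-! ## AT THE RECORD, Stage 13 (record chart `θ.ρ8 ∕ θ.bV`), under W1-20's law -/

section Record

open scoped Matrix.Norms.L2Operator

variable {𝔸 : Type*} {Ec : Type*} [NormedAddCommGroup Ec] [NormedSpace ℂ Ec]
variable (F : T4Family) (N : ℕ) [NeZero N] (m' : ℕ) (M : ℕ) [NeZero M] (hM : M = F.L ^ m')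

include hM in
/-- ★★★ **NODE N18's LETTER OF RECORD FROM ANALYTICITY OF THE MATCHED (2.13) TERMS + ONE TERM-LEVEL TWO-RUN SUP BOUND** (`M = L^{m′}`).  Under W1-20's law
`Localizes17OfRecord₁₃ F N θ S emb` and (1.21)-existence of record `PolLimitsExistOfRecord₁₃ F N θ`: holomorphic extensions of both runs' matched terms in the RECORD's β-chart `θ.ρ8`
through per-term complexifications of the probe fields of `T^{(k+2)}_{K+1}` carrying the tails `B₃ e^{−δ₀ distCT(cast t, X)}` on the colour directions `θ.bV c`, a common radius `r`, and the
two-run sup bound `‖G_B − G_A‖ ≤ M₀ θ₅^{k+1} e^{−κ d(X)}` on the ball (DISPLAYED — the node's content) ⇒ `KernelStepRateOfRecord₁₃ F N θ δ₁ θ₅ C₅′`, `δ₁ = ½min{δ₀, κ(4M)⁻¹}`,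
`C₅′ = (16M₀B₃²∕r²) e^{12Mδ₁}K₀(64,8)K₁(4,δ₀∕2)` — the letter the K3 pin reads for node N18 (skeleton v6's `U3PinnedKernels` row), produced END TO END from print-shaped analytic inputs plus
the one unprinted two-run estimate. [cite: Balaban1987RG1, Thm 1 p.259, (1.7) p.261, (1.18) p.263, (1.21) p.264, (4.35)-(4.37) p.282 and (5.10) p.293; King1986, (3.73) p.665] -/
theorem kernelStepRateOfRecord₁₃_of_holomorphicTwoRun (θ : Stage13Params F N) (S : (K : ℕ) → ClusterTower (F.P K) 𝔸 M) (emb : ReadingMaps F (MatA N) 𝔸)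
    (hloc : Localizes17OfRecord₁₃ F N θ S emb) (hex : PolLimitsExistOfRecord₁₃ F N θ)
    {θ₅ r M₀ B₃ κ δ₀ : ℝ} (hθ₅ : 0 ≤ θ₅) (hr : 0 < r) (hM₀ : 0 ≤ M₀) (hB₃ : 0 ≤ B₃) (hδ₀ : 0 < δ₀) (hκ : kappa₀ (4 * 2 ^ 4) (2 * 4) ≤ κ / 2)
    (ιc : letI := θ.instVβ₁; letI := θ.instVβ₂
      (k : ℕ) → (Fin (k + 2) → ℝ) → (K : ℕ) → (domSys (F.P (K + 1)) M (k + 1 + 1)).Dom → ((Fin (F.P (K + 1)).d → Site (F.P (K + 1)) (k + 1 + 1) → θ.Vβ) →L[ℝ] Ec))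
    (GB GA : (k : ℕ) → (Fin (k + 2) → ℝ) → (K : ℕ) → (domSys (F.P (K + 1)) M (k + 1 + 1)).Dom → Ec → ℂ)
    (U : (k : ℕ) → (Fin (k + 2) → ℝ) → (K : ℕ) → (domSys (F.P (K + 1)) M (k + 1 + 1)).Dom → Set Ec) (hU : ∀ k w K X, IsOpen (U k w K X))
    (hGB : ∀ k w K X, DifferentiableOn ℂ (GB k w K X) (U k w K X)) (hGA : ∀ k w K X, DifferentiableOn ℂ (GA k w K X) (U k w K X))
    (hrU : ∀ k w K X, ball (0 : Ec) r ⊆ U k w K X)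
    (hfB : letI := θ.instVβ₁; letI := θ.instVβ₂
      ∀ (k : ℕ) (w : Fin (k + 2) → ℝ), w ∈ Box θ.γ (k + 1) → ∀ (K : ℕ) (X : (domSys (F.P (K + 1)) M (k + 1 + 1)).Dom) (B),
        expChart (fun W' => (((S (K + 1)) (k + 1)).E w (emb (K + 1) (k + 1) W') X).re) θ.ρ8 B = (GB k w K X (ιc k w K X B)).re)
    (hfA : letI := θ.instVβ₁; letI := θ.instVβ₂
      ∀ (k : ℕ) (w : Fin (k + 2) → ℝ), w ∈ Box θ.γ (k + 1) → ∀ (K : ℕ) (X : (domSys (F.P (K + 1)) M (k + 1 + 1)).Dom) (B),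
        expChart (fun W' : Fin (F.P (K + 1)).d → Site (F.P (K + 1)) (k + 1 + 1) → MatA N =>
          (((S K) k).E (Fin.tail w) (emb K k (fun κ' y => W' κ' (siteShift (ladder F K k) y))) (castDom (domSys_succ F M K (k + 1)) X)).re) θ.ρ8 B =
          (GA k w K X (ιc k w K X B)).re)
    (hsup : ∀ (k : ℕ) (w : Fin (k + 2) → ℝ), w ∈ Box θ.γ (k + 1) → ∀ (K : ℕ) (X : (domSys (F.P (K + 1)) M (k + 1 + 1)).Dom), ∀ ζ ∈ ball (0 : Ec) r,
      ‖GB k w K X ζ - GA k w K X ζ‖ ≤ M₀ * θ₅ ^ (k + 1) * Real.exp (-κ * torusTreeLen X.1))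
    (htail : letI := θ.instVβ₁; letI := θ.instVβ₂; letI := θ.instιβ
      ∀ (k : ℕ) (w : Fin (k + 2) → ℝ) (K : ℕ) (X : (domSys (F.P (K + 1)) M (k + 1 + 1)).Dom) (l : Fin (F.P (K + 1)).d) (t : Site (F.P (K + 1)) (k + 1 + 1)) (c : θ.ιβ),
        let e : Site (F.P (K + 1)) (k + 1 + 1) → TPt 4 (domCount (F.P (K + 1)) M (k + 1 + 1) * M) :=
          fun x i => (ZMod.cast (x i) : ZMod (domCount (F.P (K + 1)) M (k + 1 + 1) * M))
        ‖ιc k w K X (Pi.single l (Pi.single t (θ.bV c)))‖ ≤ B₃ * Real.exp (-δ₀ * distCT (domCount (F.P (K + 1)) M (k + 1 + 1)) M (e t) (nearT (M := M) (e t) X))) :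
    KernelStepRateOfRecord₁₃ F N θ (delta1 δ₀ κ ((M : ℝ) * 4)) θ₅
      (16 * M₀ * B₃ ^ 2 / r ^ 2 * Real.exp (delta1 δ₀ κ ((M : ℝ) * 4) * ((M : ℝ) * 4) * 3) * K₀ (4 * 2 ^ 4) (2 * 4) * K₁ 4 (δ₀ / 2)) := by
  letI := θ.instVβ₁; letI := θ.instVβ₂; letI := θ.instιβ
  exact (kernelStepRateOfRecord₁₃_iff_of_localizes F N θ S emb hloc _ θ₅ _).2
    (kernelStepRate_localizedSum_of_holomorphicTwoRun F m' M hM S emb θ.ρ8 θ.bV ((polLimitsExistOfRecord₁₃_iff_of_localizes F N θ S emb hloc).1 hex)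
      hθ₅ hr hM₀ hB₃ hδ₀ hκ ιc GB GA U hU hGB hGA hrU hfB hfA hsup htail)

end Record

/-! ## v1.1 (append-only) — THE WINDOWED LETTER OF RECORD `WindowedStepRateOfRecord₁₃ … 1 …` (the `hS` row of the finite-volume bills, `s := 1`), leaves DISCHARGED -/

section RecordWindowed

open scoped Matrix.Norms.L2Operator
open Literature.MathematicalPhysics.QuantumFieldTheory.Balaban1983to89.Node00.U3KernelLetters (WindowedStepRateOfRecord₁₃ windowedStepRateOfRecord₁₃_iff_of_localizes)
open Literature.MathematicalPhysics.QuantumFieldTheory.Balaban1983to89.Node00 (polWindow)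

variable {𝔸 : Type*} {Ec : Type*} [NormedAddCommGroup Ec] [NormedSpace ℂ Ec]
variable (F : T4Family) (N : ℕ) [NeZero N] (m' : ℕ) (M : ℕ) [NeZero M] (hM : M = F.L ^ m')

include hM in
/-- ★★ **THE `hS` ROW OF THE FINITE-VOLUME BILLS, LEAVES DISCHARGED** (dag-n27's `…CutFSCFiniteVolume`-type bills display `WindowedStepRateOfRecord₁₃ F N θ (s F θ) κ θ₅ (C₅·θ₅)`
with the shift `s` free; here `s := 1`): under W1-20's law `Localizes17OfRecord₁₃ F N θ S emb`, Σ-shaped run-difference bounds in the record's β-chart with K-uniform soft majorants of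
weight `C_E·θ₅^{k+1}` (PART 2 §4) ⇒ `WindowedStepRateOfRecord₁₃ F N θ 1 δ₁ θ₅ (C₅′·θ₅)`, `δ₁ = ½min{δ₀, κ(4M)⁻¹}`, `C₅′ = C_E e^{12Mδ₁}K₀(64,8)K₁(4,δ₀∕2)` (PART 2's
`windowedStepRate_localizedSum_one_of_softSum` ∘ def-W1's `windowedStepRateOfRecord₁₃_iff_of_localizes`). [cite: Balaban1987RG1, Thm 1 p.259, (1.7) p.261, (1.20)-(1.21) p.264 and (5.10) p.293] -/
theorem windowedStepRateOfRecord₁₃_one_of_softSum (θ : Stage13Params F N) (S : (K : ℕ) → ClusterTower (F.P K) 𝔸 M) (emb : ReadingMaps F (MatA N) 𝔸)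
    (hloc : Localizes17OfRecord₁₃ F N θ S emb) {CE θ₅ κ δ₀ : ℝ} (hCE : 0 ≤ CE) (hθ₅ : 0 ≤ θ₅) (hδ₀ : 0 < δ₀) (hκ : kappa₀ (4 * 2 ^ 4) (2 * 4) ≤ κ / 2)
    (a : (k : ℕ) → (Fin (k + 2) → ℝ) → Fin 4 → Fin 4 → (Fin 4 → ℤ) → (K : ℕ) → (domSys (F.P (K + 1)) M (k + 1 + 1)).Dom → ℝ)
    (hΔ : letI := θ.instVβ₁; letI := θ.instVβ₂; letI := θ.instιβ
      ∀ (k : ℕ) (w : Fin (k + 2) → ℝ), w ∈ Box θ.γ (k + 1) → ∀ (μ ν : Fin 4) (z : Fin 4 → ℤ) (K : ℕ),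
        |polWindow F (K + 1) (k + 1 + 1) (localizedSum F S emb (k + 1) w (K + 1)) θ.ρ8 θ.bV μ ν z -
            polWindow F (K + 1) (k + 1 + 1)
              (fun W' : Fin (F.P (K + 1)).d → Site (F.P (K + 1)) (k + 1 + 1) → MatA N => localizedSum F S emb k (Fin.tail w) K (fun κ' y => W' κ' (siteShift (ladder F K k) y)))
              θ.ρ8 θ.bV μ ν z| ≤ ∑ X, a k w μ ν z K X)
    (ha : ∀ (k : ℕ) (w : Fin (k + 2) → ℝ), w ∈ Box θ.γ (k + 1) → ∀ (μ ν : Fin 4) (z : Fin 4 → ℤ) (K : ℕ) (X : (domSys (F.P (K + 1)) M (k + 1 + 1)).Dom),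
      let e : Site (F.P (K + 1)) (k + 1 + 1) → TPt 4 (domCount (F.P (K + 1)) M (k + 1 + 1) * M) :=
        fun x i => (ZMod.cast (x i) : ZMod (domCount (F.P (K + 1)) M (k + 1 + 1) * M))
      a k w μ ν z K X ≤ CE * θ₅ ^ (k + 1) * Real.exp (-κ * torusTreeLen X.1) *
          Real.exp (-δ₀ * distCT (domCount (F.P (K + 1)) M (k + 1 + 1)) M (e (siteOfInt F (K + 1) (k + 1 + 1) z)) (nearT (M := M) (e (siteOfInt F (K + 1) (k + 1 + 1) z)) X)) *
          Real.exp (-δ₀ * distCT (domCount (F.P (K + 1)) M (k + 1 + 1)) M (e (siteOfInt F (K + 1) (k + 1 + 1) 0)) (nearT (M := M) (e (siteOfInt F (K + 1) (k + 1 + 1) 0)) X))) :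
    WindowedStepRateOfRecord₁₃ F N θ 1 (delta1 δ₀ κ ((M : ℝ) * 4)) θ₅
      (CE * Real.exp (delta1 δ₀ κ ((M : ℝ) * 4) * ((M : ℝ) * 4) * 3) * K₀ (4 * 2 ^ 4) (2 * 4) * K₁ 4 (δ₀ / 2) * θ₅) := by
  letI := θ.instVβ₁; letI := θ.instVβ₂; letI := θ.instιβ
  exact (windowedStepRateOfRecord₁₃_iff_of_localizes F N θ S emb hloc 1 _ θ₅ _).2
    (windowedStepRate_localizedSum_one_of_softSum F m' M hM S emb θ.ρ8 θ.bV hCE hθ₅ hδ₀ hκ a hΔ ha)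

include hM in
/-- ★★ **THE `hS` ROW END TO END** (`s := 1`): under W1-20's law, analyticity of the matched (2.13) terms in the record's β-chart through per-term complexifications with the tails
`B₃ e^{−δ₀ distCT(cast t, X)}`, a common radius `r`, and the TWO-RUN SUP BOUND `‖G_B − G_A‖ ≤ M₀ θ₅^{k+1} e^{−κ d(X)}` on the ball ⇒
`WindowedStepRateOfRecord₁₃ F N θ 1 δ₁ θ₅ (C₅′·θ₅)`, `C₅′ = (16M₀B₃²∕r²) e^{12Mδ₁}K₀(64,8)K₁(4,δ₀∕2)`. [cite: Balaban1987RG1, Thm 1 p.259, (1.7) p.261, (1.20)-(1.21) p.264, (4.35)-(4.36) p.290, (4.37) p.291 and (5.10) p.293; King1986, (3.73) p.665] -/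
theorem windowedStepRateOfRecord₁₃_one_of_holomorphicTwoRun (θ : Stage13Params F N) (S : (K : ℕ) → ClusterTower (F.P K) 𝔸 M) (emb : ReadingMaps F (MatA N) 𝔸)
    (hloc : Localizes17OfRecord₁₃ F N θ S emb)
    {θ₅ r M₀ B₃ κ δ₀ : ℝ} (hθ₅ : 0 ≤ θ₅) (hr : 0 < r) (hM₀ : 0 ≤ M₀) (hB₃ : 0 ≤ B₃) (hδ₀ : 0 < δ₀) (hκ : kappa₀ (4 * 2 ^ 4) (2 * 4) ≤ κ / 2)
    (ιc : letI := θ.instVβ₁; letI := θ.instVβ₂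
      (k : ℕ) → (Fin (k + 2) → ℝ) → (K : ℕ) → (domSys (F.P (K + 1)) M (k + 1 + 1)).Dom → ((Fin (F.P (K + 1)).d → Site (F.P (K + 1)) (k + 1 + 1) → θ.Vβ) →L[ℝ] Ec))
    (GB GA : (k : ℕ) → (Fin (k + 2) → ℝ) → (K : ℕ) → (domSys (F.P (K + 1)) M (k + 1 + 1)).Dom → Ec → ℂ)
    (U : (k : ℕ) → (Fin (k + 2) → ℝ) → (K : ℕ) → (domSys (F.P (K + 1)) M (k + 1 + 1)).Dom → Set Ec) (hU : ∀ k w K X, IsOpen (U k w K X))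
    (hGB : ∀ k w K X, DifferentiableOn ℂ (GB k w K X) (U k w K X)) (hGA : ∀ k w K X, DifferentiableOn ℂ (GA k w K X) (U k w K X))
    (hrU : ∀ k w K X, ball (0 : Ec) r ⊆ U k w K X)
    (hfB : letI := θ.instVβ₁; letI := θ.instVβ₂
      ∀ (k : ℕ) (w : Fin (k + 2) → ℝ), w ∈ Box θ.γ (k + 1) → ∀ (K : ℕ) (X : (domSys (F.P (K + 1)) M (k + 1 + 1)).Dom) (B),
        expChart (fun W' => (((S (K + 1)) (k + 1)).E w (emb (K + 1) (k + 1) W') X).re) θ.ρ8 B = (GB k w K X (ιc k w K X B)).re)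
    (hfA : letI := θ.instVβ₁; letI := θ.instVβ₂
      ∀ (k : ℕ) (w : Fin (k + 2) → ℝ), w ∈ Box θ.γ (k + 1) → ∀ (K : ℕ) (X : (domSys (F.P (K + 1)) M (k + 1 + 1)).Dom) (B),
        expChart (fun W' : Fin (F.P (K + 1)).d → Site (F.P (K + 1)) (k + 1 + 1) → MatA N =>
          (((S K) k).E (Fin.tail w) (emb K k (fun κ' y => W' κ' (siteShift (ladder F K k) y))) (castDom (domSys_succ F M K (k + 1)) X)).re) θ.ρ8 B =
          (GA k w K X (ιc k w K X B)).re)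
    (hsup : ∀ (k : ℕ) (w : Fin (k + 2) → ℝ), w ∈ Box θ.γ (k + 1) → ∀ (K : ℕ) (X : (domSys (F.P (K + 1)) M (k + 1 + 1)).Dom), ∀ ζ ∈ ball (0 : Ec) r,
      ‖GB k w K X ζ - GA k w K X ζ‖ ≤ M₀ * θ₅ ^ (k + 1) * Real.exp (-κ * torusTreeLen X.1))
    (htail : letI := θ.instVβ₁; letI := θ.instVβ₂; letI := θ.instιβ
      ∀ (k : ℕ) (w : Fin (k + 2) → ℝ) (K : ℕ) (X : (domSys (F.P (K + 1)) M (k + 1 + 1)).Dom) (l : Fin (F.P (K + 1)).d) (t : Site (F.P (K + 1)) (k + 1 + 1)) (c : θ.ιβ),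
        let e : Site (F.P (K + 1)) (k + 1 + 1) → TPt 4 (domCount (F.P (K + 1)) M (k + 1 + 1) * M) :=
          fun x i => (ZMod.cast (x i) : ZMod (domCount (F.P (K + 1)) M (k + 1 + 1) * M))
        ‖ιc k w K X (Pi.single l (Pi.single t (θ.bV c)))‖ ≤ B₃ * Real.exp (-δ₀ * distCT (domCount (F.P (K + 1)) M (k + 1 + 1)) M (e t) (nearT (M := M) (e t) X))) :
    WindowedStepRateOfRecord₁₃ F N θ 1 (delta1 δ₀ κ ((M : ℝ) * 4)) θ₅
      (16 * M₀ * B₃ ^ 2 / r ^ 2 * Real.exp (delta1 δ₀ κ ((M : ℝ) * 4) * ((M : ℝ) * 4) * 3) * K₀ (4 * 2 ^ 4) (2 * 4) * K₁ 4 (δ₀ / 2) * θ₅) := by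
  letI := θ.instVβ₁; letI := θ.instVβ₂; letI := θ.instιβ
  exact (windowedStepRateOfRecord₁₃_iff_of_localizes F N θ S emb hloc 1 _ θ₅ _).2
    (windowedStepRate_localizedSum_one_of_holomorphicTwoRun F m' M hM S emb θ.ρ8 θ.bV hθ₅ hr hM₀ hB₃ hδ₀ hκ ιc GB GA U hU hGB hGA hrU hfB hfA hsup htail)

end RecordWindowed

end YMDAG.N18.RunDifferenceOfLocalTerms

end
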